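import Summits.ResolutionOfSingularities.ResolutionOfSingularities.Theorems.PurelyInseparableDim4WinCertLeafStill
import Summits.ResolutionOfSingularities.ResolutionOfSingularities.Theorems.PurelyInseparableDim4WinCertLeafSoundF8
import HarnessLib

/-!
# FCert v3 with STILL FLATS over ANY FINITE COEFFICIENT FIELD («𝔽_q / 𝔽₄ / 𝔽₈ edition» of res-rescue-typ-3 g10's `lwinCertBLS`)
# (cell `res-dim4-pi`, ∀K column)

[OURS · counted 0 · a certificate format for OUR frame v4, not about resolution] Seat res-dim4-p-8 g4 (standing offer (i), bus
2026-08-29 06:19Z).  res-rescue-typ-3 g10's `…WinCertLeafStill` (p702789) adds STILL flats (a flat whose base child mentions no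
free coordinate is discharged by ANY later row of that state, `lbaseOKS`) and `.rat`/`.mono` blind rows (`lblindOKS`) to FCert v3;
its checker `lwinCertBLS p q leafOK` is generic in the coefficient field, its soundness is typed over `ZMod p`.  This file re-types
that soundness VERBATIM for a finite field `k` with `Fintype.card k = N` (checker `lwinCertBLS N p leafOK`, cover witnesses
`x_i^N − x_i`), exactly as `…WinCertLeafSoundFq` did for `lwinCertBL`:

* `ledges_of_moveSF`, `lrowGood_of_lrowOKSF`, `lrowGood_of_lwinCertBLSF`,
  **`forall_inScopeStateWins_of_lwinCertBLSF (hN : Fintype.card k = N) (hs : LeafSoundF k p leafOK) (h : lwinCertBLS N p leafOK T = true)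
  (K) [CharP K p] (f : k →+* K)`** — every row state `⊗_f K` is in-scope escapable (invariant `LRowGoodF`, cover
  `rational_or_onFlat_or_onILeaf_card`, still branch `step_add_F_eq_of_noVars`, blind rows `not_inCoordinateScope_map_of_blindB/rblindB`);
* the DESCENTS **`forall_inScopeStateWins_of_lwinCertBLS_F4_leafOKG`** (`lwinCertBLS 4 2 (leafOKG 2) T = true` over `StepKit.F4` ⟹ every
  `𝔽₂`-rational row `s₀.castF4` in-scope escapable over EVERY field of characteristic 2) and **`…_F8_leafOKG`** (over `StepKit.F8`),
  by `AlgebraicClosure` + `F4.lift` / `F8.lift` + res-dim4-p-14's `ScopeSymmetry.inScopeStateWins_of_inScopeStateWins_map` as in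
  `…WinCertLeafSoundF4/F8`.
Nothing here proves resolution of singularities in dimension ≥ 4 / characteristic `p`; F4-C(2,2) stays OPEN; the column this feeds
certifies `InScopeStateWins` on listed roots only.  Counted 0; AI work, weaker than expert review.
bears_on: LADDER-RESOLUTION:D157-DOOR2 (res-dim4-pi · F4-C ∀K column · FCert v3 still form, 𝔽_q edition).
Supports stmt-ResolutionOfSingularities-16155 (helper).
-/

set_option linter.dupNamespace false -- mandated namespace of this single-conjunct summit

noncomputable section
open MvPolynomial Finset
open scoped BigOperators
namespace Summit.ResolutionOfSingularities.ResolutionOfSingularities.Theorems.PIDim4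

namespace WinCertLeaf

open Literature.AlgebraicGeometry.Resolution
open Literature.AlgebraicGeometry.Resolution.CentreBlowup
open StepKit WinCertSound InScopeWinCert ScopeCover ScopeBlind WinCertAllFields FlatAbsorb WinCertFlat WinCertSubst

variable {C : Type} {k : Type} [Field k] [Fintype k] [DecidableEq k]

/-! ## 2. Soundness of one row (𝔽_q edition) -/

variable {C : Type}

/-- **A good row** over `K` (as in `…WinCertLeafSound`, for the still checker): its state is in-scope escapable, and —
if it is a non-blind `p`-fold row — its centre is permissible and every `K`-edge through its centre leads to an in-scope
escapable state. [folklore] -/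
theorem ledges_of_moveSF {N : ℕ} (hN : Fintype.card k = N) {p : ℕ} [Fact p.Prime] {K : Type} [Field K] [CharP K p] [DecidableEq K]
    (f : k →+* K) {leafOK : SData 4 k → Finset (Fin 4) → ILeaf k C → Bool}
    (hs : LeafSoundF k p leafOK) {rest : LCert k C} (hrest : ∀ r ∈ rest, LRowGoodF p f r) {row : LRow k C}
    (hall : lrepliesOKB p rest row.1.1 row.1.2.1 row.2.2.1 row.2.2.2 = true)
    (hflats : lflatsOKBS p rest row.1.1 row.1.2.1 row.2.2.1 = true)
    (hleaves : lleavesOKB leafOK row.1.1 row.1.2.1 row.2.2.2 = true)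
    (hcov : lcoversOKB N p row.1.1 row.1.2.1 row.2.1 row.2.2.1 row.2.2.2 = true) :
    ∀ t, Edge p row.1.2.1 (lrowStateF f row) t → InScopeStateWins p t := by
  classical
  unfold lrepliesOKB at hall
  unfold lflatsOKBS at hflats
  unfold lleavesOKB at hleaves
  unfold lcoversOKB at hcov
  have hall' := of_decide_eq_true hall
  have hflats' := of_decide_eq_true hflats
  have hleaves' := of_decide_eq_true hleaves
  have hcov' := of_decide_eq_true hcov
  -- a flat of chart `j` absorbs every `K`-point on it
  have hflat : ∀ (j : Fin 4) (φ : Flat k), φ ∈ row.2.2.1 → φ.j = j → ∀ b : Fin 4 → K, OnFlat f φ b →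
      InScopeStateWins p (step p row.1.2.1 j b (lrowStateF f row)) := by
    intro j φ hφ hφj b hb
    obtain ⟨-, -, hbase⟩ := hflats' φ hφ
    obtain ⟨v, hv, rfl⟩ := exists_add_of_onFlat f hb
    have hstep : step p row.1.2.1 j (f ∘ φ.b0) (lrowStateF f row) =
        ⟨MvPolynomial.map f (stepD p row.1.2.1 φ.j φ.b0 row.1.1).toState.F,
          (stepD p row.1.2.1 φ.j φ.b0 row.1.1).toState.r, (stepD p row.1.2.1 φ.j φ.b0 row.1.1).toState.exc⟩ := by
      rw [lrowStateF, ← hφj, BaseChange.step_map f p row.1.2.1 φ.j φ.b0 row.1.1.toState, step_toState]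
    rcases lbaseOKS_cases hbase with hbase | ⟨hU, r, hr, hrc⟩
    · -- FCert v3's discharge: a later MOVE row avoiding `U` (flat absorption)
      obtain ⟨r, hr, hrc, hnone, huniv, hpermr, hdisj⟩ := exists_of_lbaseOK hbase
      have hgood := (hrest r hr).2 hnone huniv
      have hF : (step p row.1.2.1 j (f ∘ φ.b0) (lrowStateF f row)).F = (lrowStateF f r).F := by
        rw [hstep, lrowStateF, hrc]
      refine inScopeStateWins_step_add_of_move (S' := r.1.2.1) (fun i hi => hv i ?_) ?_ ?_
      · exact fun hiU => (Finset.disjoint_left.mp hdisj) hi hiU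
      · rw [hF]; exact hgood.1
      · intro t ht
        obtain ⟨t', ht', hFt⟩ := edge_congr hF ht
        exact inScopeStateWins_congr (hgood.2 t' ht') t hFt
    · -- a STILL flat: the child at `f ∘ b0 + v` has the base child's `F`, certified by the later row `r`
      have hc : (step p row.1.2.1 j (f ∘ φ.b0) (lrowStateF f row)).F =
          MvPolynomial.map f (evalT (stepD p row.1.2.1 φ.j φ.b0 row.1.1).L) := by
        rw [hstep, SData.toState_F]
      have hsame := step_add_F_eq_of_noVars f row.1.2.1 j hv (f ∘ φ.b0) (lrowStateF f row) hc hU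
      have hF : (step p row.1.2.1 j (f ∘ φ.b0) (lrowStateF f row)).F = (lrowStateF f r).F := by
        rw [hstep, lrowStateF, hrc]
      exact inScopeStateWins_congr (hrest r hr).1 _ (by rw [hsame, hF])
  -- a leaf of chart `j` gives a blind child at every `K`-point on it
  have hleaf : ∀ (j : Fin 4) (ℓ : ILeaf k C), ℓ ∈ row.2.2.2 → ℓ.j = j → ∀ b : Fin 4 → K, b j = 0 →
      OnLeaf f ℓ b → InScopeStateWins p (step p row.1.2.1 j b (lrowStateF f row)) := by
    intro j ℓ hℓ hℓj b hbj hb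
    obtain ⟨-, hok⟩ := hleaves' ℓ hℓ
    refine inScopeStateWins_of_not_inCoordinateScope ?_
    rw [← hℓj]
    exact hs row.1.1 row.1.2.1 ℓ hok K f b (by rw [hℓj]; exact hbj) hb
  rintro s' ⟨j, b, hj, hbj, heq, hne, rfl⟩
  have h0 : ∀ φ : Flat k, φ ∈ row.2.2.1 → φ.b0 φ.j = 0 := fun φ hφ => (hflats' φ hφ).2.1
  rcases rational_or_onFlat_or_onILeaf_card hN f (hcov' j hj) h0 hbj heq with
    ⟨b₀, hb₀j, rfl⟩ | ⟨φ, hφ, hφj, hon⟩ | ⟨ℓ, hℓ, hℓj, hon⟩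
  · -- a rational reply
    rcases hall' j hj b₀ hb₀j with h | ⟨φ, hφ, hφj, honB⟩ | ⟨ℓ, hℓ, hℓj, honB⟩
    · have heq₀ : IsEquimultiplePoint p row.1.2.1 j b₀ row.1.1.toState :=
        (BaseChange.isEquimultiplePoint_map_ringHom_iff f p row.1.2.1 j b₀ row.1.1.toState).mp heq
      have hstep := BaseChange.step_map f p row.1.2.1 j b₀ row.1.1.toState
      unfold ireplyOK at h
      rw [Bool.or_eq_true, Bool.or_eq_true] at h
      rcases h with (h1 | h2) | h3
      · rw [Bool.not_eq_true', ← Bool.not_eq_true] at h1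
        exact absurd ((isEquimultiplePoint_iff p row.1.2.1 j b₀ row.1.1).mp heq₀) h1
      · exfalso
        apply hne
        show (step p row.1.2.1 j (f ∘ b₀) (lrowStateF f row)).F = 0
        rw [lrowStateF, hstep]
        show MvPolynomial.map f (step p row.1.2.1 j b₀ row.1.1.toState).F = 0
        have hz : (step p row.1.2.1 j b₀ row.1.1.toState).F = 0 := by
          by_contra hnz
          have := (step_F_ne_zero_iff p row.1.2.1 j b₀ row.1.1).mp hnz
          rw [h2] at this
          exact Bool.noConfusion this
        rw [hz, map_zero]
      · obtain ⟨r, hr, hrc⟩ := exists_of_ichildIn h3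
        obtain ⟨ur, hur, rfl⟩ := List.mem_map.mp hr
        show InScopeStateWins p (step p row.1.2.1 j (f ∘ b₀) (lrowStateF f row))
        rw [lrowStateF, hstep, step_toState, hrc]
        exact (hrest ur hur).1
    · exact hflat j φ hφ hφj _ (onFlat_of_onFlatB f honB)
    · exact hleaf j ℓ hℓ hℓj _ (by rw [Function.comp_apply, hb₀j, map_zero]) (onLeaf_of_onLeafBL f honB)
  · exact hflat j φ hφ hφj b hon
  · exact hleaf j ℓ hℓ hℓj b hbj hon

/-- **SOUNDNESS of one row over `K`** (still checker). [folklore] -/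
theorem lrowGood_of_lrowOKSF {N : ℕ} (hN : Fintype.card k = N) {p : ℕ} [Fact p.Prime] {K : Type} [Field K] [CharP K p] [DecidableEq K]
    (f : k →+* K) {leafOK : SData 4 k → Finset (Fin 4) → ILeaf k C → Bool}
    (hs : LeafSoundF k p leafOK) {rest : LCert k C} (hrest : ∀ r ∈ rest, LRowGoodF p f r) {row : LRow k C}
    (h : lrowOKLS N p leafOK rest row = true) : LRowGoodF p f row := by
  classical
  unfold lrowOKLS at h
  rw [Bool.or_eq_true, Bool.or_eq_true] at h
  have hmove : permB p row.1.2.1 row.1.1.L = true →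
      lrepliesOKB p rest row.1.1 row.1.2.1 row.2.2.1 row.2.2.2 = true →
      lflatsOKBS p rest row.1.1 row.1.2.1 row.2.2.1 = true →
      lleavesOKB leafOK row.1.1 row.1.2.1 row.2.2.2 = true →
      lcoversOKB N p row.1.1 row.1.2.1 row.2.1 row.2.2.1 row.2.2.2 = true →
      IsPermissibleCentre p row.1.2.1 (lrowStateF f row).F ∧
        ∀ t, Edge p row.1.2.1 (lrowStateF f row) t → InScopeStateWins p t := by
    intro hS hall hflats hleaves hcov
    have hperm : IsPermissibleCentre p row.1.2.1 row.1.1.toState.F :=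
      (isPermissibleCentre_iff p row.1.2.1 row.1.1.L).mpr hS
    exact ⟨(BaseChange.isPermissibleCentre_map_iff f p row.1.2.1 _).mpr hperm,
      ledges_of_moveSF hN f hs hrest hall hflats hleaves hcov⟩
  rcases h with (hb | ht) | hm
  · -- a blindness certificate (monomial or rational curve): blind over `K`; the second clause is vacuous
    have hsome : row.1.2.2 ≠ none := by
      unfold lblindOKS at hb
      obtain ⟨⟨s, S, oβ⟩, ws, fl, lv⟩ := row
      rcases oβ with _ | ⟨c, w, α₀, a⟩ | ⟨P, v, D, kk, α₀, a⟩
      · exact absurd hb Bool.false_ne_true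
      · exact Option.some_ne_none _
      · exact Option.some_ne_none _
    refine ⟨?_, fun hnone => absurd hnone hsome⟩
    unfold lblindOKS at hb
    obtain ⟨⟨s, S, oβ⟩, ws, fl, lv⟩ := row
    rcases oβ with _ | ⟨c, w, α₀, a⟩ | ⟨P, v, D, kk, α₀, a⟩
    · exact absurd hb Bool.false_ne_true
    · exact inScopeStateWins_of_not_inCoordinateScope (not_inCoordinateScope_map_of_blindB f hb)
    · exact inScopeStateWins_of_not_inCoordinateScope (ScopeBlind.not_inCoordinateScope_map_of_rblindB (f := f) hb)
  · -- origin not `p`-fold; the second clause is vacuous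
    rw [Bool.not_eq_true'] at ht
    constructor
    · refine inScopeStateWins_of_no_permissible fun S hS => ?_
      exact no_permissible_of_not_permB ht S ((BaseChange.isPermissibleCentre_map_iff f p S _).mp hS)
    · intro _ huniv
      rw [ht] at huniv
      exact absurd huniv Bool.false_ne_true
  · simp only [Bool.and_eq_true] at hm
    obtain ⟨⟨⟨⟨hS, hall⟩, hflats⟩, hleaves⟩, hcov⟩ := hm
    have hm' := hmove hS hall hflats hleaves hcov
    exact ⟨inScopeStateWins_move row.1.2.1 hm'.1 hm'.2, fun _ _ => hm'⟩

/-! ## 3. Soundness of a certificate over every field `K ⊇ k` of characteristic `p` -/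

/-- **SOUNDNESS OVER EVERY FIELD OF CHARACTERISTIC `p`** (still checker): every row of a checked certificate is good
over `K`. [folklore] -/
theorem lrowGood_of_lwinCertBLSF {N : ℕ} (hN : Fintype.card k = N) {p : ℕ} [Fact p.Prime] {K : Type} [Field K] [CharP K p] [DecidableEq K]
    (f : k →+* K) {leafOK : SData 4 k → Finset (Fin 4) → ILeaf k C → Bool}
    (hs : LeafSoundF k p leafOK) : ∀ {T : LCert k C}, lwinCertBLS N p leafOK T = true → ∀ row ∈ T, LRowGoodF p f row
  | [], _ => fun row hrow => absurd hrow List.not_mem_nil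
  | row :: rest, h => by
    unfold lwinCertBLS at h
    rw [Bool.and_eq_true] at h
    have hrest := lrowGood_of_lwinCertBLSF hN f hs h.2
    intro r hr
    rcases List.mem_cons.mp hr with rfl | hr'
    · exact lrowGood_of_lrowOKSF hN f hs hrest h.1
    · exact hrest r hr'

/-- **`∀ K ⊇ k` form**: for a finite coefficient field `k` with `|k| = N`, a SOUND leaf oracle and every field `K` of
characteristic `p` receiving `k` along `f`, every row state `⊗_f K` of a certificate passing the still checker `lwinCertBLS N p`
is IN-SCOPE ESCAPABLE (`InScopeStateWins p`, player B ranging over ALL of `K⁴`). [folklore] -/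
theorem forall_inScopeStateWins_of_lwinCertBLSF {N : ℕ} (hN : Fintype.card k = N) {p : ℕ} [Fact p.Prime]
    {leafOK : SData 4 k → Finset (Fin 4) → ILeaf k C → Bool} (hs : LeafSoundF k p leafOK)
    {T : LCert k C} (h : lwinCertBLS N p leafOK T = true) (K : Type) [Field K] [CharP K p] [DecidableEq K]
    (f : k →+* K) :
    ∀ row ∈ T, InScopeStateWins p
      (⟨MvPolynomial.map f row.1.1.toState.F, row.1.1.toState.r, row.1.1.toState.exc⟩ : State K) :=
  fun row hrow => (lrowGood_of_lwinCertBLSF hN f hs h row hrow).1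


/-! ## 4. The descents: `F4`- and `F8`-coefficient still certificates decide the ∀K column for `𝔽₂`-rational rows -/

/-- **𝔽₄ still certificates over every field of characteristic 2** (generic oracle `leafOKG`). OURS. [folklore] -/
theorem forall_inScopeStateWins_of_lwinCertBLS_F4_leafOKG {T : LCert F4 (LeafCert4 F4)}
    (h : lwinCertBLS 4 2 (leafOKG 2) T = true) {s₀ : SData 4 (ZMod 2)} (hrow : ∃ row ∈ T, row.1.1 = s₀.castF4)
    (K : Type) [Field K] [CharP K 2] [DecidableEq K] :
    InScopeStateWins 2
      (⟨MvPolynomial.map (ZMod.castHom (dvd_refl 2) K) s₀.toState.F, s₀.toState.r, s₀.toState.exc⟩ : State K) := by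
  classical
  let Kb : Type := AlgebraicClosure K
  let g : K →+* Kb := algebraMap K Kb
  obtain ⟨β, hβ⟩ := ScopeBlind.exists_root_cyclotomic3 Kb
  obtain ⟨row, hrowT, hrow0⟩ := hrow
  have hw := forall_inScopeStateWins_of_lwinCertBLSF F4.card_F4 (leafSoundG (k := F4) 2) h Kb (F4.lift β hβ) row hrowT
  rw [hrow0, ← SData.map_castHom_eq_map_lift_castF4 s₀ β hβ, SData.castF4_toState_r, SData.castF4_toState_exc] at hw
  refine ScopeSymmetry.inScopeStateWins_of_inScopeStateWins_map g 2 ?_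
  have e3 : MvPolynomial.map g (MvPolynomial.map (ZMod.castHom (dvd_refl 2) K) s₀.toState.F) =
      MvPolynomial.map (ZMod.castHom (dvd_refl 2) Kb) s₀.toState.F := by
    rw [MvPolynomial.map_map, show g.comp (ZMod.castHom (dvd_refl 2) K) = ZMod.castHom (dvd_refl 2) Kb from Subsingleton.elim _ _]
  show InScopeStateWins 2
    (⟨MvPolynomial.map g (MvPolynomial.map (ZMod.castHom (dvd_refl 2) K) s₀.toState.F), s₀.toState.r, s₀.toState.exc⟩ : State Kb)
  rw [e3]
  exact hw

/-- **𝔽₈ still certificates over every field of characteristic 2** (generic oracle `leafOKG`). OURS. [folklore] -/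
theorem forall_inScopeStateWins_of_lwinCertBLS_F8_leafOKG {T : LCert F8 (LeafCert4 F8)}
    (h : lwinCertBLS 8 2 (leafOKG 2) T = true) {s₀ : SData 4 (ZMod 2)} (hrow : ∃ row ∈ T, row.1.1 = s₀.castF8)
    (K : Type) [Field K] [CharP K 2] [DecidableEq K] :
    InScopeStateWins 2
      (⟨MvPolynomial.map (ZMod.castHom (dvd_refl 2) K) s₀.toState.F, s₀.toState.r, s₀.toState.exc⟩ : State K) := by
  classical
  let Kb : Type := AlgebraicClosure K
  let g : K →+* Kb := algebraMap K Kb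
  obtain ⟨β, hβ⟩ := exists_root_cubic Kb
  obtain ⟨row, hrowT, hrow0⟩ := hrow
  have hw := forall_inScopeStateWins_of_lwinCertBLSF F8.card_F8 (leafSoundG (k := F8) 2) h Kb (F8.lift β hβ) row hrowT
  rw [hrow0, ← SData.map_castHom_eq_map_lift_castF8 s₀ β hβ, SData.castF8_toState_r, SData.castF8_toState_exc] at hw
  refine ScopeSymmetry.inScopeStateWins_of_inScopeStateWins_map g 2 ?_
  have e3 : MvPolynomial.map g (MvPolynomial.map (ZMod.castHom (dvd_refl 2) K) s₀.toState.F) =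
      MvPolynomial.map (ZMod.castHom (dvd_refl 2) Kb) s₀.toState.F := by
    rw [MvPolynomial.map_map, show g.comp (ZMod.castHom (dvd_refl 2) K) = ZMod.castHom (dvd_refl 2) Kb from Subsingleton.elim _ _]
  show InScopeStateWins 2
    (⟨MvPolynomial.map g (MvPolynomial.map (ZMod.castHom (dvd_refl 2) K) s₀.toState.F), s₀.toState.r, s₀.toState.exc⟩ : State Kb)
  rw [e3]
  exact hw

end WinCertLeaf

end Summit.ResolutionOfSingularities.ResolutionOfSingularities.Theorems.PIDim4

end
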